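import Summits.MatrixMultiplication.MatrixMultiplication.Theorems.AbelianSTPPCensusTAStatBDefs

/-!
# T_A certificate, second range `5001 … 5666` (static t*-indexed linear checker): kernel evaluation, shape checks, volumes `4225 … 4632`

Cell mm-stpp (rung F-M1), threshold T_A = `τ = 2.371`; checker in `AbelianSTPPCensusTAStatBDefs.lean`, table in `AbelianSTPPCensusTAStatBData.lean`.
`decide` with kernel reduction (standard axioms; no `native_decide`), `Elab.async false`, one theorem per chunk of volumes; consumed by
`TAStatB.checkV_sound` / `TAStatB.domV_sound` in the leaf `AbelianSTPPCensusLeafTA5666Closed.lean`.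
WHAT THIS IS NOT: arithmetic on shape lists only; no statement about STPP families or `ω`.
-/

set_option linter.dupNamespace false
set_option autoImplicit false
set_option Elab.async false

namespace Summit.MatrixMultiplication.MatrixMultiplication.Theorems.TAStatB

set_option maxHeartbeats 0 in
/-- Check chunk: every sorted candidate shape of the volumes `4225 … 4320` passes `checkShape` (45477 (shape, bucket) checks). [original] -/
theorem ck4225 : TAStatB.checkV 96 4225 = true := by decide +kernel

set_option maxHeartbeats 0 in
/-- Check chunk: every sorted candidate shape of the volumes `4321 … 4424` passes `checkShape` (45916 (shape, bucket) checks). [original] -/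
theorem ck4321 : TAStatB.checkV 104 4321 = true := by decide +kernel

set_option maxHeartbeats 0 in
/-- Check chunk: every sorted candidate shape of the volumes `4425 … 4524` passes `checkShape` (46085 (shape, bucket) checks). [original] -/
theorem ck4425 : TAStatB.checkV 100 4425 = true := by decide +kernel

set_option maxHeartbeats 0 in
/-- Check chunk: every sorted candidate shape of the volumes `4525 … 4632` passes `checkShape` (45620 (shape, bucket) checks). [original] -/
theorem ck4525 : TAStatB.checkV 108 4525 = true := by decide +kernel

end Summit.MatrixMultiplication.MatrixMultiplication.Theorems.TAStatB
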